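import Literature.AnabelianGeometry.EtaleTheta.MuTwoSettingCLevel
import Literature.AnabelianGeometry.SemiGraphs.TemperedCompletionExistence
import HarnessLib

/-!
# [EtTh] §2 over §1: `Π^tp_C` is residually finite, hence HAS an injective profinite completion `Π_C`
# (proof-only; census input P-C1 of W3-L2-02 DISCHARGED modulo the open-embedding datum)

Mochizuki, *The étale theta function and its Frobenioid-theoretic manifestations*, Publ. RIMS **45**
(2009), §2 p. 36 (printed 262): "`Π_C` … the (profinite) étale fundamental group of `C^log`", with
"`Π^tp_C`" its tempered counterpart (p. 38, [SemiAnbd] Prop. 3.6: "natural injection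
`Π^temp ↪ Π = (Π^temp)^∧`") [cite: MochizukiEtTh2009, Prop 2.4 p.38].

Cell abc-iut, layer L2, W3-L2-02 (seat abc-iut-L2-d3), PROOF-ONLY companion (no `def`) of
`MuTwoSettingCLevel.lean`. The census (HOME/…/W3-L2-02-CENSUS.md) listed as input P-C1 "a profinite
completion `Π^tp_C → Π_C` with `IsProfiniteCompletion` and injective" — the `toHat`/`PiC` fields of
abc-iut-L2-t2's `ThetaCovers.TemperedCoverData`, and need (i) of the L6 `CoreTower` witness
(abc-iut-w5-d052). By abc-iut-L3's `IsProfiniteCompletion.exists_isProfiniteCompletion_injective`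
(`TemperedCompletionExistence.lean`: every topological group has a profinite completion, injective iff
its open normal subgroups of finite index separate points) it suffices that `Π^tp_C` be RESIDUALLY
FINITE; this follows from the §1 data — `Π^tp_X ↪ Π_X` injective (`TemperedCurve.toHat_injective`) into
the profinite `Π_X`, `Π^tp_X ⊴ Π^tp_C` open of index `2` — and the open-embedding field of
`MuTwoSetting.CLevelData` (the pull-back of a separating open normal subgroup of `Π_X` is open of finite
index in `Π^tp_X`; its image in `Π^tp_C` is open of finite index; its normal core separates):

* `MuTwoSetting.CLevelData.exists_openNormal_finiteIndex_not_mem` — residual finiteness of `Π^tp_C`;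
* `MuTwoSetting.CLevelData.exists_isProfiniteCompletion_injective` — **P-C1 as a THEOREM**:
  `∃ (Π_C : ProfiniteGrp) (ι : Π^tp_C →ₜ* Π_C), IsProfiniteCompletion ι ∧ Function.Injective ι`.

Nothing here asserts that a `MuTwoSetting` exists; no side is taken on [IUTchIII] Cor. 3.12; typed ≠ proved.
-/

noncomputable section

namespace Literature.AnabelianGeometry.EtaleTheta

open Literature.AnabelianGeometry.SemiGraphs
open _root_.Topology

namespace MuTwoSetting.CLevelData

variable {p : ℕ} [Fact p.Prime] {M : MuTwoSetting p}

/-- The pull-back to `Π^tp_X` of an open normal subgroup of the profinite `Π_X` has finite index.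
[cite: MochizukiSemiAnbd2006, §6 p.69] -/
theorem finiteIndex_comap_toHat (V : OpenNormalSubgroup M.PiHat) :
    (V.toSubgroup.comap M.toHat.toMonoidHom).FiniteIndex := by
  haveI : CompactSpace M.PiHat := M.isProfiniteCompletion_toHat.compactSpace
  haveI : V.toSubgroup.FiniteIndex := Subgroup.finiteIndex_of_finite_quotient
  haveI : V.toSubgroup.IsFiniteRelIndex M.toHat.toMonoidHom.range :=
    Subgroup.isFiniteRelIndex_of_finiteIndex
  exact ⟨by rw [Subgroup.index_comap]; exact Subgroup.relIndex_ne_zero⟩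

/-- The image in `Π^tp_C` of a finite-index subgroup of `Π^tp_X` has finite index
(`[Π^tp_C : Π^tp_X] = 2`, `inclX` injective). [cite: MochizukiEtTh2009, Def 1.7 p.27] -/
theorem finiteIndex_map_inclX (W : Subgroup M.PiTemp) [W.FiniteIndex] : (W.map M.inclX).FiniteIndex := by
  refine ⟨?_⟩
  rw [Subgroup.index_map, (MonoidHom.ker_eq_bot_iff M.inclX).2 M.injective_inclX, sup_bot_eq,
    M.index_range_inclX]
  exact mul_ne_zero Subgroup.FiniteIndex.index_ne_zero two_ne_zero

/-- **`Π^tp_C` is residually finite**: its open normal subgroups of finite index separate points. For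
`g ∉ Π^tp_X` the open normal subgroup `Π^tp_X` of index `2` separates; for `g = inclX x`, `x ≠ 1`, a
separating open normal subgroup `V` of the profinite `Π_X` (`toHat` injective) pulls back to an open
finite-index `W ≤ Π^tp_X`, whose image in `Π^tp_C` is open (open-embedding field) of finite index, and
the normal core of that image is open, normal, of finite index, and misses `g`.
[cite: MochizukiEtTh2009, Prop 2.4 p.38] -/
theorem exists_openNormal_finiteIndex_not_mem (e : M.CLevelData) {g : M.GtpC} (hg : g ≠ 1) :
    ∃ U : OpenNormalSubgroup M.GtpC, U.toSubgroup.FiniteIndex ∧ g ∉ U.toSubgroup := by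
  classical
  by_cases hgr : g ∈ M.inclX.range
  · obtain ⟨x, rfl⟩ := hgr
    have hx : x ≠ 1 := fun h => hg (by rw [h, map_one])
    have hxH : M.toHat x ≠ 1 := fun h => hx (M.toHat_injective (by rw [h, map_one]))
    haveI : CompactSpace M.PiHat := M.isProfiniteCompletion_toHat.compactSpace
    haveI : T2Space M.PiHat := M.isProfiniteCompletion_toHat.t2Space
    haveI : TotallyDisconnectedSpace M.PiHat := M.isProfiniteCompletion_toHat.totallyDisconnectedSpace
    obtain ⟨V, hV⟩ := ProfiniteGrp.exist_openNormalSubgroup_sub_open_nhds_of_one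
      (isOpen_compl_singleton (x := M.toHat x)) (by simpa using hxH.symm)
    -- `W = toHat⁻¹ V ≤ Π^tp_X`: open, of finite index, missing `x`
    let W : Subgroup M.PiTemp := V.toSubgroup.comap M.toHat.toMonoidHom
    have hWo : IsOpen (W : Set M.PiTemp) := V.isOpen'.preimage M.toHat.continuous
    haveI : W.FiniteIndex := finiteIndex_comap_toHat V
    have hxW : x ∉ W := fun h => hV h rfl
    -- `H = inclX(W) ≤ Π^tp_C`: open, of finite index, missing `inclX x`
    let H : Subgroup M.GtpC := W.map M.inclX
    have hHo : IsOpen (H : Set M.GtpC) := by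
      rw [Subgroup.coe_map]
      exact e.isOpenEmbedding_inclX.isOpenMap _ hWo
    haveI : H.FiniteIndex := finiteIndex_map_inclX W
    have hgH : M.inclX x ∉ H := fun h => hxW ((Subgroup.mem_map_iff_mem M.injective_inclX).1 h)
    -- its normal core
    refine ⟨⟨⟨H.normalCore, Subgroup.isOpen_of_isClosed_of_finiteIndex _
      (H.normalCore_isClosed (H.isClosed_of_isOpen hHo))⟩, inferInstance⟩,
      Subgroup.finiteIndex_normalCore H, fun h => hgH (H.normalCore_le h)⟩
  · refine ⟨⟨⟨M.inclX.range, M.isOpen_range_inclX⟩, M.range_inclX_normal⟩, ?_, hgr⟩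
    exact ⟨by rw [M.index_range_inclX]; exact two_ne_zero⟩

/-- **P-C1 as a theorem: `Π^tp_C` has an injective profinite completion `Π^tp_C ↪ Π_C`** satisfying
abc-iut-L3's frozen `IsProfiniteCompletion` — the shape of the `PiC`/`toHat`/
`isProfiniteCompletion_toHat`/`injective_toHat` fields of `ThetaCovers.TemperedCoverData` ("`Π_C`, the
profinite étale fundamental group of `C^log`", p. 36; [SemiAnbd] Prop. 3.6 "natural injection").
[cite: MochizukiEtTh2009, Prop 2.4 p.38] -/
theorem exists_isProfiniteCompletion_injective (e : M.CLevelData) :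
    ∃ (P : ProfiniteGrp.{0}) (ι : M.GtpC →ₜ* P), IsProfiniteCompletion ι ∧ Function.Injective ι :=
  IsProfiniteCompletion.exists_isProfiniteCompletion_injective M.GtpC
    fun _ hg => e.exists_openNormal_finiteIndex_not_mem hg

end MuTwoSetting.CLevelData

end Literature.AnabelianGeometry.EtaleTheta

end
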